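import Summits.ResolutionOfSingularities.ResolutionOfSingularities.Theorems.FrobeniusClosingSteerWords11HighHalf

/-!
# Crux `Steer` (stmt-ResolutionOfSingularities-16345), line `switching-dichotomy` — ORDER-INDUCTION WORDS: §σ2.32 THE FIRST-CLEANED-ORDER INDUCTION ON THE T-LINE + §σ2.33 ITS THREADING THROUGH THE WORDS11 HALF OF THE hEv → T PATH (author res-L0-w41-strat-2 g3; plan-1 RULINGS 164c/166a/167b/170b/173b; Theses-free, sorry-free; v3)

Filed for the author by res-L0-w41-stub-4 (RULINGS 172a/173b; planners do not propose to `Theorems/`); text = res-L0-w41-strat-2's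
`L/res-L0-w41-strat-2/r46/FrobeniusClosingSteerOrderInductionWords.v3.lean` byte for byte. Conventions as in `…Words01Core` / `…Words11HighHalf`
(«(folklore)» on `def … : Prop` words, «[folklore]» on proved glue). Nothing here is a statement of the manuscript
[claim: Hironaka2017, status: under-review]. OURS (candidates / vocabulary; AI review is weaker than expert review).

WHY (res-L0-w41-idea-2 LEMMA N `Sketch-hev-shadow-idea2.lean` 88d4156578559e0c): the [hEv-∞-6] sub-case of the T-line binder hEv wants an
INDUCTIVE BINDER — `Concl` for every core datum over the same valuation ring of strictly smaller first cleaned order — which only a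
top-level induction over DATA can discharge (`Concl` is run-free). §σ2.32 is that induction (pure logic: strong induction on an order NOT
reached by the radicand; no finiteness lemma); §σ2.33 threads the binder through the Words11 half of the (pointwise) hEv → T path and through
the one non-pointwise step, the normalised start (ENRICHED word `NormalisedStartReachTwo`, S-sized for its owner).

* §σ2.32: `CleanerReaches`, `cleanerReaches_mono`, `ConclBelowDatum` (THE binder), `ConclBelow` + `conclBelow_of_conclBelowDatum`,
  `EternalSteeredRunTwoInd`, `eternalSteeredRunTwo_of_firstOrderInduction : SteeredExit → SteeredRunExists → EmptyStallTwo →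
  EternalSteeredRunTwoInd → EternalSteeredRunTwo`, `eternalSteeredRunTwo_of_ind` (over the Words07 leaves), `MemberReaches` (the
  slack-1 NO-RISE word of v1/v2 is RETIRED — refuted in tri-3's coordinate toy, plan-1 RULING 173a; the leaf's pattern is §σ2.34's).
* §σ2.33: twins `SteeredTailConclIndTwoN` / `HighOrderTailConclIndTwoN` / `HighWanderConclIndTwoN` / `EternalSteeredRunTwoNInd` (the Words11
  words + ONE last hypothesis `ConclBelowDatum p k K O A₀ t`), lifts `…_of_plain`, glue twins `steeredTailConclIndTwoN_of_orders`,
  `highOrderTailConclIndTwoN_of_split`, `eternalSteeredRunTwoNInd_of`, `NormalisedStartReachTwo` + `normalisedStartTwo_of_reach`,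
  `eternalSteeredRunTwoInd_of_normalStart`, root assemblies `eternalSteeredRunTwo_of_indLine` / `eternalSteeredRunTwo_of_indSplit`.
  The SKELETON half (twins of `StrippingTailHighConclTwoN` / `…WildConclTwoN` / `…SwitchingConclTwoN` / `…SwitchingEvenConclTwoN`, of
  `_of_fork` / `_of_persistence_fork` / `heightSplitX` / parityK, and slate16ᴵ over `eternalSteeredRunTwo_of_indSplit`) rides r46.
* §σ2.34 (tri-3 ROW R-AC N-2, plan-1 RULING 171b): the slack the induction step really needs is 3, not 1 — `CleanedOrderSlackTwoN c`
  («eventually, at point-step stages, member reaches `d + c` ⇒ start reaches `d`»; c = 3 OPEN, the stepwise form false at forced surface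
  centres), `cleanedOrderSlackTwoN_mono`, `concl_shadow_of_slack` (LEMMA N drop `2μ ≥ 4` + EFO₃ ⇒ the binder fires at `d = 2e − 3`).
-/


set_option linter.dupNamespace false

namespace Summit.ResolutionOfSingularities.ResolutionOfSingularities.Theorems.SwitchingDichotomy.Words

open IsLocalRing
open Literature.AlgebraicGeometry.Resolution (locAtCentre)
open Summit.ResolutionOfSingularities.ResolutionOfSingularities.Theorems.SteerRankThinness

namespace OrderInduction


variable {K : Type} [Field K]

/-- **A cleaner of `t ^ p` reaches order `d`** at the member `locAtCentre B O`: `t ^ p − g ^ p ∈ 𝔪 ^ d` for some `g`. OURS. (folklore) -/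
def CleanerReaches (p : ℕ) (O : ValuationSubring K) (B : Subring K) (t : K) (d : ℕ) : Prop :=
  ∃ (_ : IsLocalRing (locAtCentre B O)) (ht : t ^ p ∈ locAtCentre B O) (g : locAtCentre B O),
    (⟨t ^ p, ht⟩ : locAtCentre B O) - g ^ p ∈ maximalIdeal (locAtCentre B O) ^ d

/-- `CleanerReaches` is antitone in the order. Pure logic (`Ideal.pow_le_pow_right`). OURS. [folklore] -/
theorem cleanerReaches_mono {p : ℕ} {O : ValuationSubring K} {B : Subring K} {t : K} {d n : ℕ}
    (h : CleanerReaches p O B t d) (hnd : n ≤ d) : CleanerReaches p O B t n := by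
  obtain ⟨hloc, ht, g, hg⟩ := h
  exact ⟨hloc, ht, g, Ideal.pow_le_pow_right hnd hg⟩

/-- **The inductive binder, keyed to the datum**: `Concl` for every core datum (`n = 4`) over the same `O` whose radicand misses
some order that `t ^ p` reaches (first cleaned order strictly smaller). OURS. (folklore) -/
def ConclBelowDatum (p : ℕ) (k K : Type) [Field k] [CharP k p] [PerfectField k] [Field K] [Algebra k K]
    (O : ValuationSubring K) (A₀ : Subalgebra k K) (t : K) : Prop :=
  ∀ (A₀' : Subalgebra k K) (h₀' : A₀'.toSubring ≤ O.toSubring) (t' : K),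
    CoreDatum p 4 k K O A₀' h₀' t' →
    (∃ d : ℕ, CleanerReaches p O A₀.toSubring t d ∧ ¬ CleanerReaches p O A₀'.toSubring t' d) →
    Concl O A₀' t'

/-- **idea-2's shape** (`HevShadowIdea2.ConclBelow p k K O d`, restated over `CleanerReaches`): `Concl` for every core datum over `O`
whose radicand reaches no cleaner of order `d`. OURS. (folklore) -/
def ConclBelow (p : ℕ) (k K : Type) [Field k] [CharP k p] [PerfectField k] [Field K] [Algebra k K]
    (O : ValuationSubring K) (d : ℕ) : Prop :=
  ∀ (A₀' : Subalgebra k K) (h₀' : A₀'.toSubring ≤ O.toSubring) (t' : K),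
    CoreDatum p 4 k K O A₀' h₀' t' → ¬ CleanerReaches p O A₀'.toSubring t' d → Concl O A₀' t'

/-- From the datum-keyed binder to idea-2's order-keyed one at any order the datum's radicand REACHES. Pure logic. OURS. [folklore] -/
theorem conclBelow_of_conclBelowDatum {p : ℕ} {k K : Type} [Field k] [CharP k p] [PerfectField k] [Field K] [Algebra k K]
    {O : ValuationSubring K} {A₀ : Subalgebra k K} {t : K} (h : ConclBelowDatum p k K O A₀ t) {d : ℕ}
    (hd : CleanerReaches p O A₀.toSubring t d) : ConclBelow p k K O d :=
  fun A₀' h₀' t' core' hnd => h A₀' h₀' t' core' ⟨d, hd, hnd⟩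

/-- **T with the inductive binder**: `EternalSteeredRunTwo` whose conclusion may use `ConclBelowDatum p k K O A₀ t`. OURS. (folklore) -/
def EternalSteeredRunTwoInd : Prop :=
  ∀ p : ℕ, p = 2 →
    ∀ (k K : Type) [Field k] [CharP k p] [PerfectField k] [Field K] [Algebra k K]
    (O : ValuationSubring K) (A₀ : Subalgebra k K) (h₀ : A₀.toSubring ≤ O.toSubring) (t : K),
    CoreDatum p 4 k K O A₀ h₀ t → ¬ HasProperCoarsening O →
    ∀ (R : ℕ → Subring K) (P : (i : ℕ) → Ideal (R i)) (s : ℕ → K),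
      R 0 = locAtCentre A₀.toSubring O → IsSteeredRun O R P t p s →
      ConclBelowDatum p k K O A₀ t → Concl O A₀ t

/-- **§σ2.32 glue — the first-cleaned-order induction.** From X (`SteeredExit`, landed), E (`SteeredRunExists`, landed), B₂
(`EmptyStallTwo`, closed) and T-with-binder, T follows: `Concl` is run-free, so strong induction on an order NOT reached by the radicand
serves every datum with an unreached order, and a datum reaching every order is served last. Pure logic. OURS. [folklore] -/
theorem eternalSteeredRunTwo_of_firstOrderInduction (hX : SteeredExit) (hE : SteeredRunExists) (hB : EmptyStallTwo)
    (h : EternalSteeredRunTwoInd) : EternalSteeredRunTwo := by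
  intro p hp2 k K _ _ _ _ _ O A₀ h₀ t core hrk R P s hR0 hrun
  have hp : p.Prime := hp2 ▸ Nat.prime_two
  -- every datum over `O` that carries the inductive binder has `Concl` (run trichotomy + X + B₂ + T-with-binder)
  have key : ∀ (A₀' : Subalgebra k K) (h₀' : A₀'.toSubring ≤ O.toSubring) (t' : K),
      CoreDatum p 4 k K O A₀' h₀' t' → ConclBelowDatum p k K O A₀' t' → Concl O A₀' t' := by
    intro A₀' h₀' t' core' hbelow
    rcases hE p hp 4 le_rfl k K O A₀' h₀' t' core' with
      ⟨R', P', s', N, hR0', hrun', hexit | hstall⟩ | ⟨R', P', s', hR0', hrun'⟩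
    · exact hX p hp 4 le_rfl k K O A₀' h₀' t' core' R' P' s' N hR0' hrun' hexit
    · exact (hB p hp2 4 le_rfl k K O A₀' h₀' t' core' R' P' s' N hR0' hrun' hstall).elim
    · exact h p hp2 k K O A₀' h₀' t' core' hrk R' P' s' hR0' hrun' hbelow
  -- strong induction on an order `n` NOT reached by the radicand
  have main : ∀ (n : ℕ) (A₀' : Subalgebra k K) (h₀' : A₀'.toSubring ≤ O.toSubring) (t' : K),
      CoreDatum p 4 k K O A₀' h₀' t' → ¬ CleanerReaches p O A₀'.toSubring t' n → Concl O A₀' t' := by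
    intro n
    induction n using Nat.strong_induction_on with
    | _ n ih =>
      intro A₀' h₀' t' core' hn
      refine key A₀' h₀' t' core' ?_
      rintro A₀'' h₀'' t'' core'' ⟨d, hd, hnd⟩
      have hdn : d < n := lt_of_not_ge fun hge => hn (cleanerReaches_mono hd hge)
      exact ih d hdn A₀'' h₀'' t'' core'' hnd
  -- the given datum: its binder only asks for data with an unreached order
  refine key A₀ h₀ t core ?_
  rintro A₀' h₀' t' core' ⟨d, -, hnd⟩
  exact main d A₀' h₀' t' core' hnd

/-- **An order reached at a run member**: `R` is local, `s ^ p ∈ R` and `s ^ p − g ^ p ∈ 𝔪_R ^ d` for some `g : R`. OURS. (folklore) -/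
def MemberReaches (p : ℕ) (R : Subring K) (s : K) (d : ℕ) : Prop :=
  ∃ (_ : IsLocalRing R) (hs : s ^ p ∈ R) (g : R), (⟨s ^ p, hs⟩ : R) - g ^ p ∈ maximalIdeal R ^ d

/-- **T ⟸ T-with-binder, over the tree leaves** X (`steeredExit_holds`), E (`steeredRunExists_holds`), B₂ (`emptyStallTwo_holds`).
Pure logic. OURS. [folklore] -/
theorem eternalSteeredRunTwo_of_ind (h : EternalSteeredRunTwoInd) : EternalSteeredRunTwo :=
  eternalSteeredRunTwo_of_firstOrderInduction steeredExit_holds steeredRunExists_holds emptyStallTwo_holds h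

/-! ### §σ2.33 — threading the binder through the Words11 half of the hEv → T path (pure logic) -/

section Threading

/-- **NSʳ · NormalisedStartReachTwo** (ENRICHED `NormalisedStartTwo`, S-sized for its owner): the normalised datum `(A₁, t₁)` reaches NO
order that `(A₀, t)` does not reach (with `t₁ = (t − g)/h` over the same `locAtCentre`: `t² − (g + h g₁)² = h² (t₁² − g₁²)`). OURS. (folklore) -/
def NormalisedStartReachTwo : Prop :=
  ∀ p : ℕ, p = 2 →
    ∀ (k K : Type) [Field k] [CharP k p] [PerfectField k] [Field K] [Algebra k K]
    (O : ValuationSubring K) (A₀ : Subalgebra k K) (h₀ : A₀.toSubring ≤ O.toSubring) (t : K),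
    CoreDatum p 4 k K O A₀ h₀ t →
      Concl O A₀ t ∨ ∃ (A₁ : Subalgebra k K) (h₁ : A₁.toSubring ≤ O.toSubring) (t₁ : K),
        CoreDatum p 4 k K O A₁ h₁ t₁ ∧ NormalAt O (locAtCentre A₁.toSubring O) p t₁ ∧ (Concl O A₁ t₁ → Concl O A₀ t) ∧
        (∀ d : ℕ, CleanerReaches p O A₁.toSubring t₁ d → CleanerReaches p O A₀.toSubring t d)

/-- NSʳ ⇒ NS (forget the reach clause). Pure logic. OURS. [folklore] -/
theorem normalisedStartTwo_of_reach (h : NormalisedStartReachTwo) : NormalisedStartTwo := by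
  intro p hp2 k K _ _ _ _ _ O A₀ h₀ t core
  rcases h p hp2 k K O A₀ h₀ t core with hC | ⟨A₁, h₁, t₁, core₁, hN₁, himp, -⟩
  · exact Or.inl hC
  · exact Or.inr ⟨A₁, h₁, t₁, core₁, hN₁, himp⟩

/-- **STEERED TAILᴺᴵ** — `SteeredTailConclTwoN` with the inductive binder. OURS. (folklore) -/
def SteeredTailConclIndTwoN : Prop :=
  ∀ p : ℕ, p = 2 →
    ∀ (k K : Type) [Field k] [CharP k p] [PerfectField k] [Field K] [Algebra k K]
    (O : ValuationSubring K) (A₀ : Subalgebra k K) (h₀ : A₀.toSubring ≤ O.toSubring) (t : K),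
    CoreDatum p 4 k K O A₀ h₀ t → ¬ HasProperCoarsening O →
    ∀ (R : ℕ → Subring K) (P : (i : ℕ) → Ideal (R i)) (s : ℕ → K),
      R 0 = locAtCentre A₀.toSubring O → NormalAt O (R 0) p t → IsSteeredRun O R P t p s →
      (¬ ∃ i₀ c : ℕ, 1 ≤ c ∧ IsDominantTail R P i₀ c) → ConclBelowDatum p k K O A₀ t → Concl O A₀ t

/-- **HIGHᴺᴵ** — `HighOrderTailConclTwoN` with the inductive binder. OURS. (folklore) -/
def HighOrderTailConclIndTwoN : Prop :=
  ∀ p : ℕ, p = 2 →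
    ∀ (k K : Type) [Field k] [CharP k p] [PerfectField k] [Field K] [Algebra k K]
    (O : ValuationSubring K) (A₀ : Subalgebra k K) (h₀ : A₀.toSubring ≤ O.toSubring) (t : K),
    CoreDatum p 4 k K O A₀ h₀ t → ¬ HasProperCoarsening O →
    ∀ (R : ℕ → Subring K) (P : (i : ℕ) → Ideal (R i)) (s : ℕ → K),
      R 0 = locAtCentre A₀.toSubring O → NormalAt O (R 0) p t → IsSteeredRun O R P t p s →
      (¬ ∃ i₀ c : ℕ, 1 ≤ c ∧ IsDominantTail R P i₀ c) →
      (∃ i₀ : ℕ, ∀ i, i₀ ≤ i → IsHighOrderAt R s p i) → ConclBelowDatum p k K O A₀ t → Concl O A₀ t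

/-- **HIGH WANDERᴺᴵ** — `HighWanderConclTwoN` with the inductive binder. OURS. (folklore) -/
def HighWanderConclIndTwoN : Prop :=
  ∀ p : ℕ, p = 2 →
    ∀ (k K : Type) [Field k] [CharP k p] [PerfectField k] [Field K] [Algebra k K]
    (O : ValuationSubring K) (A₀ : Subalgebra k K) (h₀ : A₀.toSubring ≤ O.toSubring) (t : K),
    CoreDatum p 4 k K O A₀ h₀ t → ¬ HasProperCoarsening O →
    ∀ (R : ℕ → Subring K) (P : (i : ℕ) → Ideal (R i)) (s : ℕ → K),
      R 0 = locAtCentre A₀.toSubring O → NormalAt O (R 0) p t → IsSteeredRun O R P t p s →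
      (¬ ∃ i₀ c : ℕ, 1 ≤ c ∧ IsDominantTail R P i₀ c) →
      (∀ i₀ : ℕ, ∃ i, i₀ ≤ i ∧ ¬ IsPointStep R P i) →
      (∃ i₀ : ℕ, ∀ i, i₀ ≤ i → IsHighOrderAt R s p i) → ConclBelowDatum p k K O A₀ t → Concl O A₀ t

/-- **Tᴺᴵ** — `EternalSteeredRunTwoN` with the inductive binder. OURS. (folklore) -/
def EternalSteeredRunTwoNInd : Prop :=
  ∀ p : ℕ, p = 2 →
    ∀ (k K : Type) [Field k] [CharP k p] [PerfectField k] [Field K] [Algebra k K]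
    (O : ValuationSubring K) (A₀ : Subalgebra k K) (h₀ : A₀.toSubring ≤ O.toSubring) (t : K),
    CoreDatum p 4 k K O A₀ h₀ t → ¬ HasProperCoarsening O →
    ∀ (R : ℕ → Subring K) (P : (i : ℕ) → Ideal (R i)) (s : ℕ → K),
      R 0 = locAtCentre A₀.toSubring O → NormalAt O (R 0) p t → IsSteeredRun O R P t p s →
      ConclBelowDatum p k K O A₀ t → Concl O A₀ t

/-- Binder-free ⇒ binder (the twin is WEAKER). Pure logic. OURS. [folklore] -/
theorem steeredTailConclIndTwoN_of_plain (h : SteeredTailConclTwoN) : SteeredTailConclIndTwoN :=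
  fun p hp k K _ _ _ _ _ O A₀ h₀ t core hrk R P s hR0 hN hrun hnd _ =>
    h p hp k K O A₀ h₀ t core hrk R P s hR0 hN hrun hnd

/-- Binder-free ⇒ binder. Pure logic. OURS. [folklore] -/
theorem highOrderTailConclIndTwoN_of_plain (h : HighOrderTailConclTwoN) : HighOrderTailConclIndTwoN :=
  fun p hp k K _ _ _ _ _ O A₀ h₀ t core hrk R P s hR0 hN hrun hnd hhigh _ =>
    h p hp k K O A₀ h₀ t core hrk R P s hR0 hN hrun hnd hhigh

/-- Binder-free ⇒ binder. Pure logic. OURS. [folklore] -/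
theorem highWanderConclIndTwoN_of_plain (h : HighWanderConclTwoN) : HighWanderConclIndTwoN :=
  fun p hp k K _ _ _ _ _ O A₀ h₀ t core hrk R P s hR0 hN hrun hnd hio hhigh _ =>
    h p hp k K O A₀ h₀ t core hrk R P s hR0 hN hrun hnd hio hhigh

/-- Binder-free ⇒ binder. Pure logic. OURS. [folklore] -/
theorem eternalSteeredRunTwoNInd_of_plain (h : EternalSteeredRunTwoN) : EternalSteeredRunTwoNInd :=
  fun p hp k K _ _ _ _ _ O A₀ h₀ t core hrk R P s hR0 hN hrun _ =>
    h p hp k K O A₀ h₀ t core hrk R P s hR0 hN hrun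

/-- Regime glue, normalised, WITH the binder (twin of `steeredTailConclTwoN_of_orders`; LOWᴺ stays binder-free). Pure logic. OURS. [folklore] -/
theorem steeredTailConclIndTwoN_of_orders (hH : HighOrderTailConclIndTwoN) (hL : LowOrderTailConclTwoN) :
    SteeredTailConclIndTwoN := by
  intro p hp k K _ _ _ _ _ O A₀ h₀ t hcore hrk R P s hR0 hN hrun hnd hbelow
  by_cases h : ∃ i₀ : ℕ, ∀ i, i₀ ≤ i → IsHighOrderAt R s p i
  · exact hH p hp k K O A₀ h₀ t hcore hrk R P s hR0 hN hrun hnd h hbelow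
  · refine hL p hp k K O A₀ h₀ t hcore hrk R P s hR0 hN hrun hnd fun i₀ => ?_
    by_contra hc
    exact h ⟨i₀, fun i hi => by_contra fun hni => hc ⟨i, hi, hni⟩⟩

/-- HIGH split, normalised, WITH the binder (twin of `highOrderTailConclTwoN_of_split`; point tails stay binder-free). Pure logic.
OURS. [folklore] -/
theorem highOrderTailConclIndTwoN_of_split (hP : PointTailHighConclTwo) (hW : HighWanderConclIndTwoN) :
    HighOrderTailConclIndTwoN := by
  intro p hp k K _ _ _ _ _ O A₀ h₀ t hcore hrk R P s hR0 hN hrun hnd hhigh hbelow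
  by_cases h : ∃ i₀ : ℕ, ∀ i, i₀ ≤ i → IsPointStep R P i
  · exact hP p hp k K O A₀ h₀ t hcore hrk R P s hR0 hrun h hhigh
  · refine hW p hp k K O A₀ h₀ t hcore hrk R P s hR0 hN hrun hnd (fun i₀ => ?_) hhigh hbelow
    by_contra hc
    exact h ⟨i₀, fun i hi => by_contra fun hni => hc ⟨i, hi, hni⟩⟩

/-- **Tᴺᴵ from its line** (twin of `eternalSteeredRunTwoN_of`: GeoDict + codimension bound + K(1..3) kill dominant tails, binder-free;
the steered tail carries the binder). Pure logic. OURS. [folklore] -/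
theorem eternalSteeredRunTwoNInd_of (hTail : SteeredTailConclIndTwoN) (hG : GeoDict) (hcb : TailCodimBound)
    (hK1 : ∀ p : ℕ, p.Prime → NoEternalIsolatedRadicandChain p 1)
    (hK2 : ∀ p : ℕ, p.Prime → NoEternalIsolatedRadicandChain p 2)
    (hK3 : ∀ p : ℕ, p.Prime → NoEternalIsolatedRadicandChain p 3) : EternalSteeredRunTwoNInd := by
  intro p hp2 k K _i1 _i2 _i3 _i4 _i5 O A₀ h₀ t core hrank R P s hR0 hN hrun hbelow
  have hp : p.Prime := hp2 ▸ Nat.prime_two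
  by_cases htail : ∃ i₀ c : ℕ, 1 ≤ c ∧ IsDominantTail R P i₀ c
  · obtain ⟨i₀, c, hc1, ht⟩ := htail
    have hnc : ¬ NoEternalIsolatedRadicandChain p c := hG p hp 4 le_rfl k K O A₀ h₀ t core R P s i₀ c hR0 hrun ht
    have hc4 : c + 1 ≤ 4 := hcb p hp 4 le_rfl k K O A₀ h₀ t core R P s i₀ c hR0 hrun ht
    have hc3 : c ≤ 3 := by omega
    interval_cases c
    · exact (hnc (hK1 p hp)).elim
    · exact (hnc (hK2 p hp)).elim
    · exact (hnc (hK3 p hp)).elim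
  · exact hTail p hp2 k K O A₀ h₀ t core hrank R P s hR0 hN hrun htail hbelow

/-- **THE NORMALISED KERNEL WITH THE BINDER** (twin of `eternalSteeredRunTwo_of_normalStart`, the ONE non-pointwise step of the
path): NSʳ gives `Concl` or a normalised datum `(A₁, t₁)` reaching no new orders, so the binder TRANSFERS (`ConclBelowDatum` for `(A₀, t)`
⇒ for `(A₁, t₁)`); σ_top is re-run from `(A₁, t₁)` (E/X/B₂ by name, Words07). Pure logic. OURS. [folklore] -/
theorem eternalSteeredRunTwoInd_of_normalStart (hNS : NormalisedStartReachTwo) (hT : EternalSteeredRunTwoNInd) :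
    EternalSteeredRunTwoInd := by
  intro p hp2 k K _i1 _i2 _i3 _i4 _i5 O A₀ h₀ t core hrank _R _P _s _hR0 _hrun hbelow
  have hp : p.Prime := hp2 ▸ Nat.prime_two
  rcases hNS p hp2 k K O A₀ h₀ t core with hC | ⟨A₁, h₁, t₁, core₁, hN₁, himp, hreach⟩
  · exact hC
  · apply himp
    have hbelow₁ : ConclBelowDatum p k K O A₁ t₁ := fun A' h' t' core' ⟨d, hd, hnd⟩ =>
      hbelow A' h' t' core' ⟨d, hreach d hd, hnd⟩
    rcases steeredRunExists_holds p hp 4 le_rfl k K O A₁ h₁ t₁ core₁ with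
      ⟨R₁, P₁, s₁, N, hR0₁, hrun₁, hexit | hstall⟩ | ⟨R₁, P₁, s₁, hR0₁, hrun₁⟩
    · exact steeredExit_holds p hp 4 le_rfl k K O A₁ h₁ t₁ core₁ R₁ P₁ s₁ N hR0₁ hrun₁ hexit
    · exact (emptyStallTwo_holds p hp2 4 le_rfl k K O A₁ h₁ t₁ core₁ R₁ P₁ s₁ N hR0₁ hrun₁ hstall).elim
    · exact hT p hp2 k K O A₁ h₁ t₁ core₁ hrank R₁ P₁ s₁ hR0₁ (hR0₁ ▸ hN₁) hrun₁ hbelow₁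

/-- **ROOT ASSEMBLY (line form)**: T ⟸ NSʳ + STEERED TAILᴺᴵ + the two named facts (twin of `eternalSteeredRunTwo_of_normalised_debts`, then
§σ2.32's induction). Pure logic. OURS. [folklore] -/
theorem eternalSteeredRunTwo_of_indLine (hNS : NormalisedStartReachTwo) (hTail : SteeredTailConclIndTwoN)
    (hL : Literature.AlgebraicGeometry.Resolution.Lipman1978NoEternalNormalBranch.{0})
    (hCP : Literature.AlgebraicGeometry.Resolution.CossartPiltant2019HironakaLUIsolatedBranch.{0}) : EternalSteeredRunTwo :=
  eternalSteeredRunTwo_of_ind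
    (eternalSteeredRunTwoInd_of_normalStart hNS
      (eternalSteeredRunTwoNInd_of hTail geoDict_holds tailCodimBound_holds noEternalIsolatedRadicandChain_one_holds
        (noEternalIsolatedRadicandChain_two_of_lipman hL) (noEternalIsolatedRadicandChain_three_of_CP hCP)))

/-- **ROOT ASSEMBLY (split form)**: T ⟸ NSʳ + PointTailHigh + HIGH WANDERᴺᴵ + LOWᴺ + the two named facts (twin of
`eternalSteeredRunTwo_of_normalised_split_debts`). The skeleton's r46 slate feeds `hW` from `heightSplitXᴵ ∘ forkᴵ ∘ persistence_forkᴵ ∘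
parityKᴵ (…, hEvᴵ)`. Pure logic. OURS. [folklore] -/
theorem eternalSteeredRunTwo_of_indSplit (hNS : NormalisedStartReachTwo) (hP : PointTailHighConclTwo)
    (hW : HighWanderConclIndTwoN) (hLow : LowOrderTailConclTwoN)
    (hL : Literature.AlgebraicGeometry.Resolution.Lipman1978NoEternalNormalBranch.{0})
    (hCP : Literature.AlgebraicGeometry.Resolution.CossartPiltant2019HironakaLUIsolatedBranch.{0}) : EternalSteeredRunTwo :=
  eternalSteeredRunTwo_of_indLine hNS
    (steeredTailConclIndTwoN_of_orders (highOrderTailConclIndTwoN_of_split hP hW) hLow) hL hCP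

end Threading


/-! ### §σ2.34 — THE SLACK THE INDUCTION REALLY NEEDS (tri-3 ROW R-AC N-2 / plan-1 RULING 171b): not NO-RISE (slack 1) but slack 3 -/

section Slack

variable {K : Type} [Field K]

/-- **EFO_c · CleanedOrderSlackTwoN c** (SUPPORT word, eventual point-step form; c = 3 is what the [hEv-∞-6] induction step consumes, c = 1 is
NO-RISE restricted to point steps): T's binders VERBATIM ⇒ eventually, at every POINT-step stage `i`, if the member radicand `s i ^ p` reaches
order `d + c` in `R i` then the START radicand reaches order `d` («eventual point-step cleaned order ≤ first cleaned order + c»). The STEPWISE /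
all-stages form is FALSE at forced surface centres (tri-3 toy `f = y³w + x⁷`, E 4 → 5); the eventual point-step form with c = 3 is OPEN. OURS. (folklore) -/
def CleanedOrderSlackTwoN (c : ℕ) : Prop :=
  ∀ p : ℕ, p = 2 →
    ∀ (k K : Type) [Field k] [CharP k p] [PerfectField k] [Field K] [Algebra k K]
    (O : ValuationSubring K) (A₀ : Subalgebra k K) (h₀ : A₀.toSubring ≤ O.toSubring) (t : K),
    CoreDatum p 4 k K O A₀ h₀ t → ¬ HasProperCoarsening O →
    ∀ (R : ℕ → Subring K) (P : (i : ℕ) → Ideal (R i)) (s : ℕ → K),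
      R 0 = locAtCentre A₀.toSubring O → IsSteeredRun O R P t p s →
      ∃ i₀ : ℕ, ∀ i, i₀ ≤ i → IsPointStep R P i → ∀ d : ℕ,
        MemberReaches p (R i) (s i) (d + c) → CleanerReaches p O A₀.toSubring t d

/-- Slack is monotone: EFO_c ⇒ EFO_c' for `c ≤ c'`. Pure logic. OURS. [folklore] -/
theorem cleanedOrderSlackTwoN_mono {c c' : ℕ} (h : CleanedOrderSlackTwoN c) (hcc : c ≤ c') : CleanedOrderSlackTwoN c' := by
  intro p hp2 k K _ _ _ _ _ O A₀ h₀ t core hrk R P s hR0 hrun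
  obtain ⟨i₀, hi₀⟩ := h p hp2 k K O A₀ h₀ t core hrk R P s hR0 hrun
  refine ⟨i₀, fun i hi hpt d hreach => hi₀ i hi hpt d ?_⟩
  obtain ⟨hloc, hs, g, hg⟩ := hreach
  exact ⟨hloc, hs, g, Ideal.pow_le_pow_right (by omega) hg⟩

/-- **HOW THE LEAF SERVES THE DIVISOR SHADOW WITH SLACK 3** (the leaf's pattern; plan-1 RULING 173a): at a late point-step
stage `i` of exact cleaned order `2e` (`e ≥ 3`) the shadow datum `(A₀', t')` reaches NO order `≥ 2e − 3` (LEMMA N with `μ ≥ 2`: first cleaned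
order `≤ 2e − 4`), the member reaches `2e = (2e − 3) + 3`, so EFO₃ makes the START reach `2e − 3` and the binder fires. Pure logic. OURS. [folklore] -/
theorem concl_shadow_of_slack {p : ℕ} {k : Type} [Field k] [CharP k p] [PerfectField k] [Algebra k K]
    {O : ValuationSubring K} {A₀ : Subalgebra k K} {t : K} {R : Subring K} {s : K} {e : ℕ}
    (hbelow : ConclBelowDatum p k K O A₀ t)
    (hslack : ∀ d : ℕ, MemberReaches p R s (d + 3) → CleanerReaches p O A₀.toSubring t d)
    (he : 3 ≤ e) (hreach : MemberReaches p R s (2 * e))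
    {A₀' : Subalgebra k K} {h₀' : A₀'.toSubring ≤ O.toSubring} {t' : K} (core' : CoreDatum p 4 k K O A₀' h₀' t')
    (hshadow : ¬ CleanerReaches p O A₀'.toSubring t' (2 * e - 3)) : Concl O A₀' t' := by
  refine hbelow A₀' h₀' t' core' ⟨2 * e - 3, hslack (2 * e - 3) ?_, hshadow⟩
  have h23 : 2 * e - 3 + 3 = 2 * e := by omega
  rw [h23]; exact hreach

end Slack

end OrderInduction

end Summit.ResolutionOfSingularities.ResolutionOfSingularities.Theorems.SwitchingDichotomy.Words
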